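import Summits.BirchSwinnertonDyer.BirchSwinnertonDyer.Theorems.PrintCf2SplitBadTwoFiniteTwistTranslationCharModule
import Literature.NumberTheory.EllipticCurves.Rubin1991.TwoVariableDualDataScalarCharacterTwist
import Literature.GroupTheory.Abelian.CocyclicPruferUniqueness
import HarnessLib

/-!
# Crux `PrintCf2.SplitBadTwoRankOneOfFacts` (stmt-BirchSwinnertonDyer-20368), road α — the TWIST DATA of a cocyclic `Γ_K`-module with
# SCALAR `ℤ₂ˣ`-character (e.g. the pinned CM summand `W* = W[v̄^∞]`) at `p = 2`: its sign `θ` (framed, `θ² = 1`), the Hecke character `θK`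
# and avatar of the sign, an identification with `charModule ∅ θ`, and the `DualData₂`-transport `htr` with a twisting function `c ≡ 1 (mod 4)`

HONEST FRAMING. Helper file (`--supports stmt-BirchSwinnertonDyer-20368`); Theses-free; theorems only; nothing here closes the crux
or a registered stub; no summit statement is proved. Cell `bsd-print-cf2`, width seat `bsd-line-cf2-p1-w5` g2; steps (iii)–(v) of the
S3b′ «twist» recipe `Cruxes/SplitBadTwoRankOneOfFacts/S3B-TWIST-RECIPE-w5g2.md`, ASSEMBLED into one theorem.

Inputs BY NAME: -w4 g7's `QuadraticPart.exists_sign_heckeChar_avatar` (sign `θ̂` of `χ : Γ_K →ₜ* ℤ₂ˣ`, framed `θ`, `θK` with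
`IsHeckeCharOf`, exact ramification, `θK² = 1`, avatar `r`, `χθ̂ ≡ 1 (mod 4)`, `χθ̂ = 1` on every `pairKer`), this seat's
`Cocyclic.nonempty_addEquiv_qpModZp` (p664713: cocyclic `p`-primary `≃+ ℚ_p/ℤ_p`), `KellerYin2024.charModuleEquiv`, and
`CharTwist.exists_dualData₂_of_scalarChar` (p664322).

* §1 `unitChar_eq_of_sign` — for the framed sign `θ` of (iii) (`θ σ² = 1`, `θ σ = 1 ↔ θ̂ σ = 1`, `θ̂ = ±1`): `unitChar θ = θ̂`;
  `eq_unitChar_of_mul_sign_eq_one` — hence `χ = unitChar θ` wherever `χθ̂ = 1` (the `hagree` of (v)).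
* §2 **`exists_twistData_of_scalarChar_two`** — for `K` imaginary quadratic, a `2`-primary cocyclic discrete `Γ_K`-module `M′` on which
  `Γ_K` acts through `χ : Γ_K →ₜ* ℤ₂ˣ` (levelwise), and ANY generator pair: `∃ θ θK r φ c …` with `θ σ² = 1`, `IsHeckeCharOf ι θ θK`, exact
  ramification, `θK² = 1`, `IsPAdicAvatarOf ι θK r`, `φ : M′ ≃+ charModule ∅ θ`, `c = χ·(unitChar θ)⁻¹ ≡ 1 (mod 4)`, `c = 1` on `pairKer`,
  and `htr`: every `DualData₂ κ₁ κ₂ M′ v̄ γ₁ γ₂` is a `DualData₂ κ₁ κ₂ (charModule ∅ θ) v̄ γ₁ γ₂` with scalars through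
  `ι_c = unitTwist₂Equiv (c γ₁) (c γ₂)`. What then remains for `twoVariableMCShape_charTwist` (p662016) is ONLY the avatar `e` of a Hecke
  character `η` with `e = c` read in `ℚ̄₂` — the named fact (D-Gal) of the recipe's §2 when `M′ = W*`.

BSD is not proved by any of this; no summit statement is proved by this seat.
References: [GreenbergLNM1716] §4 pp. 105–107; [SerreAbelianLadic1968] Ch. I §1.2, Ch. III §2.3; [Kaplansky1954] §9 Ex. 23;
[NeukirchANT1999] VII (10.6); [KellerYin2024] §1.1.
-/

-- D-0017: single-problem summit, so `Summit.BirchSwinnertonDyer.BirchSwinnertonDyer.…` repeats a namespace BY DESIGN.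
set_option linter.dupNamespace false
set_option autoImplicit false

noncomputable section

open scoped Classical
open NumberField IsDedekindDomain Field
open Literature.NumberTheory.GaloisRepresentations Literature.NumberTheory.EllipticCurves
open Literature.NumberTheory.EllipticCurves.KellerYin2024
open Summit.BirchSwinnertonDyer.BirchSwinnertonDyer.Theorems.EisensteinPrimesMuLambda

namespace Summit.BirchSwinnertonDyer.BirchSwinnertonDyer.Theorems.PrintCf2.FiniteTwist

/-! ## §1 The unit character of a framed sign -/

section Sign

variable {K : Type} [Field K]

/-- A unit of `ℤ₂` with square `1` is `±1`. [cite: SerreAbelianLadic1968, Ch. III §2.3] -/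
theorem units_eq_one_or_eq_neg_one_of_sq {u : ℤ_[2]ˣ} (hu : u ^ 2 = 1) : u = 1 ∨ u = -1 := by
  have h : (u : ℤ_[2]) * (u : ℤ_[2]) = 1 := by rw [← sq, ← Units.val_pow_eq_pow_val, hu, Units.val_one]
  rcases mul_self_eq_one_iff.mp h with h1 | h1
  · exact Or.inl (Units.ext h1)
  · exact Or.inr (Units.ext (by rw [h1, Units.val_neg, Units.val_one]))

/-- **`unitChar θ = θ̂` for the framed sign**: if `θ σ² = 1`, `θ σ = 1 ↔ θ̂ σ = 1` and `θ̂ σ = ±1`, then `unitChar θ σ = θ̂ σ`.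
[cite: SerreAbelianLadic1968, Ch. III §2.3] [cite: KellerYin2024, §1.1 (arXiv:2402.12781v2 TeX L441–449)] -/
theorem unitChar_eq_of_sign {θs : absoluteGaloisGroup K →ₜ* ℤ_[2]ˣ} (hθs : ∀ σ, θs σ = 1 ∨ θs σ = -1)
    {θ : FramedGaloisRep K (padicCoeffIntegers (∅ : Set (PadicAlgCl 2))) 1} (hθ2 : ∀ σ, θ σ ^ 2 = 1)
    (hθ1 : ∀ σ, θ σ = 1 ↔ θs σ = 1) (σ : absoluteGaloisGroup K) : unitChar θ σ = θs σ := by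
  rcases hθs σ with h | h
  · rw [h, unitChar_eq_one_of_apply_eq_one θ ((hθ1 σ).mpr h)]
  · rw [h]
    rcases units_eq_one_or_eq_neg_one_of_sq (unitChar_pow_eq_one θ hθ2 σ) with h1 | h1
    · -- `unitChar θ σ = 1` forces `θ σ = 1`, contradicting `θ̂ σ = -1`
      exfalso
      have hentry : entry (∅ : Set (PadicAlgCl 2)) θ σ = 1 := by
        rw [show entry (∅ : Set (PadicAlgCl 2)) θ σ = padicIntEquivCoeffIntegersEmpty 2 ((unitChar θ σ : ℤ_[2]ˣ) : ℤ_[2])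
          from (padicIntEquiv_unitChar θ σ).symm, h1, Units.val_one, map_one]
      have hσ : θs σ = 1 := (hθ1 σ).mp (apply_eq_one_of_entry_eq_one _ θ σ hentry)
      rw [h] at hσ
      have h2 := congrArg (fun u : ℤ_[2]ˣ ↦ PadicInt.toZModPow 2 (u : ℤ_[2])) hσ
      simp only [Units.val_neg, Units.val_one, map_neg, map_one] at h2
      exact absurd h2 (by decide)
    · exact h1

/-- Hence `χ σ = unitChar θ σ` wherever `χ σ · θ̂ σ = 1` (the hypothesis `hagree` of `CharTwist.exists_dualData₂_of_scalarChar` on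
`Gal(K̄/K̃_∞)`). [cite: GreenbergLNM1716, §4 p. 107] -/
theorem eq_unitChar_of_mul_sign_eq_one {θs : absoluteGaloisGroup K →ₜ* ℤ_[2]ˣ} (hθs : ∀ σ, θs σ = 1 ∨ θs σ = -1)
    {θ : FramedGaloisRep K (padicCoeffIntegers (∅ : Set (PadicAlgCl 2))) 1} (hθ2 : ∀ σ, θ σ ^ 2 = 1)
    (hθ1 : ∀ σ, θ σ = 1 ↔ θs σ = 1) {χ : absoluteGaloisGroup K →ₜ* ℤ_[2]ˣ} {σ : absoluteGaloisGroup K}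
    (h : χ σ * θs σ = 1) : χ σ = unitChar θ σ := by
  rw [unitChar_eq_of_sign hθs hθ2 hθ1 σ]
  have hinv : χ σ = (θs σ)⁻¹ := eq_inv_of_mul_eq_one_left h
  rw [hinv]
  rcases hθs σ with h1 | h1 <;> rw [h1] <;> simp

/-- The inverse of a sign is itself. [cite: SerreAbelianLadic1968, Ch. III §2.3] -/
theorem sign_inv_eq_self {θs : absoluteGaloisGroup K →ₜ* ℤ_[2]ˣ} (hθs : ∀ σ, θs σ = 1 ∨ θs σ = -1)
    (σ : absoluteGaloisGroup K) : (θs σ)⁻¹ = θs σ := by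
  rcases hθs σ with h | h <;> rw [h] <;> simp

end Sign

/-! ## §2 The twist data of a cocyclic module with scalar character, at `p = 2` -/

section TwistData

variable {K : Type} [Field K] [NumberField K]

/-- **TWIST DATA OF A COCYCLIC MODULE WITH SCALAR CHARACTER (p = 2).** Let `K` be imaginary quadratic, `M′` a discrete `Γ_K`-module which
is `2`-primary and cocyclic (for every `k` an element of order `2^k` generating the `2^k`-torsion) and on which `Γ_K` acts through a continuous
`χ : Γ_K →ₜ* ℤ₂ˣ` levelwise, and let `(κ₁, κ₂; γ₁, γ₂)` be a generator pair of the `ℤ₂²`-tower. Then there are: a framed sign `θ` (`θ σ² = 1`),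
its Hecke character `θK` (`IsHeckeCharOf ι θ θK`, exact ramification, `θK² = 1`) and avatar `r` (`IsPAdicAvatarOf ι θK r`), an additive
identification `φ : M′ ≃+ charModule ∅ θ`, and the twisting function `c := χ·(unitChar θ)⁻¹` with `c ≡ 1 (mod 4)`, `c = 1` on `Gal(K̄/K̃_∞)`,
such that every `Λ₂`-dual datum of `H¹_{nr}(K̃_∞, M′)` is a dual datum of `H¹_{nr}(K̃_∞, charModule ∅ θ)` with scalars through
`ι_c = unitTwist₂Equiv (c γ₁) (c γ₂)`. [cite: GreenbergLNM1716, §4 p. 107] [cite: NeukirchANT1999, Ch. VII §10 Thm. (10.6)]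
[cite: SerreAbelianLadic1968, Ch. III §2.3] [cite: Kaplansky1954, §9 Exercise 23 (PDF p. 24)] -/
theorem exists_twistData_of_scalarChar_two (hK : IsImaginaryQuadratic K) (ι : PadicAlgCl 2 ≃+* ℂ)
    {M' : Type} [AddCommGroup M'] [DistribMulAction (absoluteGaloisGroup K) M'] [TopologicalSpace M'] [DiscreteTopology M']
    (htors : ∀ x : M', ∃ k : ℕ, 2 ^ k • x = 0)
    (hcyc : ∀ k : ℕ, ∃ g : M', addOrderOf g = 2 ^ k ∧ ∀ x : M', 2 ^ k • x = 0 → x ∈ AddSubgroup.zmultiples g)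
    (χ : absoluteGaloisGroup K →ₜ* ℤ_[2]ˣ)
    (hχ : ∀ (σ : absoluteGaloisGroup K) (k : ℕ) (x : M'), 2 ^ k • x = 0 →
      σ • x = (PadicInt.toZModPow k (χ σ : ℤ_[2])).val • x)
    {κ₁ κ₂ : ZpExtension K 2} {γ₁ γ₂ : absoluteGaloisGroup K} (hpair : ZpExtension.IsTopGeneratorPair κ₁ κ₂ γ₁ γ₂)
    (vbar : HeightOneSpectrum (𝓞 K)) :
    ∃ (θ : FramedGaloisRep K (padicCoeffIntegers (∅ : Set (PadicAlgCl 2))) 1) (θK : HeckeCharacter K)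
      (r : FramedGaloisRep K (PadicAlgCl 2) 1) (φ : M' ≃+ charModule (∅ : Set (PadicAlgCl 2)) θ)
      (c : absoluteGaloisGroup K → ℤ_[2]ˣ)
      (h₁ : ‖((c γ₁ : ℤ_[2]ˣ) : ℤ_[2]) - 1‖ < 1) (h₂ : ‖((c γ₂ : ℤ_[2]ˣ) : ℤ_[2]) - 1‖ < 1),
      (∀ σ, θ σ ^ 2 = 1) ∧ IsHeckeCharOf ι θ θK ∧
      (∀ w : HeightOneSpectrum (𝓞 K), θK.IsUnramifiedAt w ↔ θ.IsUnramifiedAt w) ∧ θK * θK = 1 ∧ IsPAdicAvatarOf ι θK r ∧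
      (∀ σ, c σ = χ σ * (unitChar θ σ)⁻¹) ∧ (∀ σ, (4 : ℤ_[2]) ∣ (c σ : ℤ_[2]) - 1) ∧
      (∀ σ ∈ ZpExtension.pairKer κ₁ κ₂, c σ = 1) ∧
      (∀ (σ : absoluteGaloisGroup K) (k : ℕ) (t : M'), 2 ^ k • t = 0 →
        φ (σ • t) = (PadicInt.toZModPow k (c σ : ℤ_[2])).val • (σ • φ t)) ∧
      ∀ D' : DualData₂ κ₁ κ₂ M' vbar γ₁ γ₂,
        ∃ (D : DualData₂ κ₁ κ₂ (charModule (∅ : Set (PadicAlgCl 2)) θ) vbar γ₁ γ₂) (e : D'.X ≃+ D.X),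
          ∀ (ρ : IwasawaAlgebra₂ 2) (x : D'.X), e (ρ • x) = PadicIntSeries.unitTwist₂Equiv (c γ₁) (c γ₂) h₁ h₂ ρ • e x := by
  haveI : Fact (Nat.Prime 2) := ⟨Nat.prime_two⟩
  -- (iii) the sign data of `χ`
  obtain ⟨θs, θ, θK, r, hθs, hθsχ, hθ2, hθ1, -, hH, hram, hθK2, -, -, hav, hker⟩ :=
    QuadraticPart.exists_sign_heckeChar_avatar (∅ : Set (PadicAlgCl 2)) ι hK χ
  -- (iv) an additive identification with `charModule ∅ θ`
  obtain ⟨e₀⟩ := Literature.GroupTheory.Abelian.Cocyclic.nonempty_addEquiv_qpModZp htors hcyc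
  let φ : M' ≃+ charModule (∅ : Set (PadicAlgCl 2)) θ := e₀.trans (charModuleEquiv θ).symm
  -- the twisting function and its properties
  have hunit : ∀ σ, unitChar θ σ = θs σ := unitChar_eq_of_sign hθs hθ2 hθ1
  have hc4 : ∀ σ, (4 : ℤ_[2]) ∣ ((χ σ * (unitChar θ σ)⁻¹ : ℤ_[2]ˣ) : ℤ_[2]) - 1 := fun σ ↦ by
    rw [hunit, sign_inv_eq_self hθs, Units.val_mul]; exact hθsχ σ
  have hagree : ∀ σ ∈ ZpExtension.pairKer κ₁ κ₂, χ σ = unitChar θ σ := fun σ hσ ↦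
    eq_unitChar_of_mul_sign_eq_one hθs hθ2 hθ1 (hker hpair hσ)
  refine ⟨θ, θK, r, φ, fun σ ↦ χ σ * (unitChar θ σ)⁻¹, norm_units_sub_one_lt_one_two _, norm_units_sub_one_lt_one_two _,
    hθ2, hH, hram, hθK2, hav, fun σ ↦ rfl, hc4, fun σ hσ ↦ by beta_reduce; rw [hagree σ hσ, mul_inv_cancel],
    fun σ k t ht ↦ CharTwist.hφ_of_scalarChar θ (fun σ ↦ χ σ) hχ φ σ k t ht, fun D' ↦ ?_⟩
  -- (v) the transport
  exact CharTwist.exists_dualData₂_of_scalarChar θ (fun σ ↦ χ σ) hχ φ hagree _ _ D'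

end TwistData

end Summit.BirchSwinnertonDyer.BirchSwinnertonDyer.Theorems.PrintCf2.FiniteTwist

end
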